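import Mathlib
import HarnessLib
import Summits.AtomisticToContinuum.HydrodynamicLimit.Theorems.MourreKoopmanChargesOneBodyCompletenessTorusStatics
import Summits.AtomisticToContinuum.HydrodynamicLimit.Theorems.MourreKoopmanChargesOneBodyCompletenessProfileDensityAllDensity
import Summits.AtomisticToContinuum.HydrodynamicLimit.Theorems.AntiMazurCoboundariesVarianceCertificate
import Literature.MathematicalPhysics.KineticTheory.HardSphereWindowPressureStatic

/-!
# `OneBodyCompleteness` · line `torus_fejer` v2, stub `stub_profileDensityAll`:
# all-window variance decay passes from bounded to polynomially bounded profiles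

Support file for the crux item stmt-AtomisticToContinuum-9583 (`OneBodyCompleteness`, route
`MourreKoopmanCharges` of `AtomisticToContinuum/HydrodynamicLimit`), proving the registered stub
`stub_profileDensityAll` of the skeleton `Cruxes/OneBodyCompleteness/Lines/torus_fejer.lean` (v2).

Setting: the canonical law `G = localGibbsLaw σ 1 0 θ N (Φ N)` of `N + 1` hard spheres on `𝕋³`
(`0 < σ < 1/2`, `0 < θ`), a continuous `χ`, the one-body field `A_f(z) = ∫ χ(y.1) f(y.2) d(emp z)` and
the Fejér functional `F_N^f(T) = ∫ (T⁻¹ ∫₀ᵀ A_f((Φ N)_{s(N+1)^{-1/3}} z) ds)² dG`.  Claim: eventual decay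
`F_N^g(T) ≤ δ/(N+1)` for EVERY bounded continuous `g ⊥ {1, v, |v|²}` implies the same for every
continuous polynomially bounded `h ⊥ {1, v, |v|²}`.  Proof: (i) density (part A, file
`…ProfileDensityAllDensity`): a bounded continuous `g ⊥ {1, v, |v|²}` with `(∫χ²) ∫ (h-g)² M_θ ≤ δ/4`;
(ii) the uniform seminorm bound `F_N^f(T) ≤ (∫χ²)(∫f²M_θ)/(N+1)` for the mean-zero `f = h - g`, every
window and `N` (time rescaling, Cauchy–Schwarz in time on good orbits — orbit integrability from
CONTINUITY of `A_f` —, Tonelli + invariance, and the statics `torusStaticVariance`);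
(iii) `A_h = A_g + A_f`, `(x + y)² ≤ 2x² + 2y²`.

References: H. Spohn, *Large Scale Dynamics of Interacting Particles* (1991), Part II §7.1. Folklore.
-/

noncomputable section

namespace Summit.AtomisticToContinuum.HydrodynamicLimit.Theorems.MourreKoopmanChargesOneBodyCompleteness

open MeasureTheory ProbabilityTheory Filter Topology Set
open scoped ENNReal BigOperators
open Literature.Analysis.FluidPDE Literature.MathematicalPhysics.KineticTheory
open UnitAddTorus
open Summit.AtomisticToContinuum.HydrodynamicLimit.Theorems.MourreKoopmanChargesIdealGasNoDecay
open Summit.AtomisticToContinuum.HydrodynamicLimit.Theorems.AntiMazurCoboundariesVarianceCertificate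

namespace stub_profileDensityAllAux

/-! ### Windows along good orbits of a hard-sphere flow on `𝕋³` (continuous observables) -/

section Flow

variable {N : ℕ} {ε : ℝ}

/-- **Time averages have stationary expectation (Tonelli + invariance)**, for a nonnegative CONTINUOUS
observable `g` (bounded or not): for a law `μ` invariant under every `Φ_t` and carried by the good set,
and a window `a ≤ b`, `∫ (∫ₐᵇ g(Φ_u z) du) dμ = (b - a) ∫ g dμ` as lower Lebesgue integrals (orbit
integrability by energy conservation, `HardSphereFlow.intervalIntegrable_comp_flow_of_continuous`).
[folklore] -/
theorem lintegral_ofReal_window_of_continuous (Φ : HardSphereFlow (Torus.geometry (Fin 3)) ε N)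
    (μ : Measure (Config N (Fin 3) T3)) [SFinite μ]
    (hinv : ∀ t, MeasurePreserving (Φ.flow t) μ μ) (hgood : μ Φ.goodᶜ = 0)
    {g : Config N (Fin 3) T3 → ℝ} (hg : Continuous g) (hg0 : ∀ w, 0 ≤ g w) {a b : ℝ}
    (hab : a ≤ b) :
    ∫⁻ z, ENNReal.ofReal (∫ s in a..b, g (Φ.flow s z)) ∂μ =
      ENNReal.ofReal (b - a) * ∫⁻ z, ENNReal.ofReal (g z) ∂μ := by
  -- adapted from `AntiMazurCoboundariesVarianceCertificate.lintegral_ofReal_window` (bounded `g`)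
  have hae : ∀ᵐ z ∂μ, z ∈ Φ.good := mem_ae_iff.2 hgood
  have hgm : Measurable g := hg.measurable
  have h1 : ∀ᵐ z ∂μ, ENNReal.ofReal (∫ s in a..b, g (Φ.flow s z)) =
      ∫⁻ s, ENNReal.ofReal (g (Φ.flow s z)) ∂(volume.restrict (Ioc a b)) := by
    filter_upwards [hae] with z hz
    rw [intervalIntegral.integral_of_le hab]
    exact ofReal_integral_eq_lintegral_ofReal
      (Φ.intervalIntegrable_comp_flow_of_continuous hz hg a b).1 (Eventually.of_forall fun s => hg0 _)
  rw [lintegral_congr_ae h1]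
  have hflow := aemeasurable_flow_prod Φ (volume.restrict (Ioc a b)) μ hgood
  have hF : AEMeasurable (fun p : ℝ × Config N (Fin 3) T3 => ENNReal.ofReal (g (Φ.flow p.1 p.2)))
      ((volume.restrict (Ioc a b)).prod μ) :=
    (hgm.comp_aemeasurable hflow).ennreal_ofReal
  have hswap : (∫⁻ z, ∫⁻ s, ENNReal.ofReal (g (Φ.flow s z)) ∂(volume.restrict (Ioc a b)) ∂μ) =
      ∫⁻ s, ∫⁻ z, ENNReal.ofReal (g (Φ.flow s z)) ∂μ ∂(volume.restrict (Ioc a b)) :=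
    (lintegral_prod_symm _ hF).symm.trans (lintegral_prod _ hF)
  rw [hswap]
  have hslice : ∀ s, ∫⁻ z, ENNReal.ofReal (g (Φ.flow s z)) ∂μ = ∫⁻ z, ENNReal.ofReal (g z) ∂μ :=
    fun s => (hinv s).lintegral_comp hgm.ennreal_ofReal
  simp only [hslice, lintegral_const, Measure.restrict_apply_univ, Real.volume_Ioc]
  rw [mul_comm]

/-- **Window averages do not increase the second moment**: for a continuous observable `F`, an
invariant law `μ` carried by the good set and a window `w > 0`,
`∫ (w⁻¹ ∫₀ʷ F(Φ_s z) ds)² dμ ≤ ∫ F² dμ` (Cauchy–Schwarz in time on good orbits, Tonelli, invariance).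
[folklore] -/
theorem lintegral_sq_window_le (Φ : HardSphereFlow (Torus.geometry (Fin 3)) ε N)
    (μ : Measure (Config N (Fin 3) T3)) [SFinite μ]
    (hinv : ∀ t, MeasurePreserving (Φ.flow t) μ μ) (hgood : μ Φ.goodᶜ = 0)
    {F : Config N (Fin 3) T3 → ℝ} (hF : Continuous F) {w : ℝ} (hw : 0 < w) :
    ∫⁻ z, ENNReal.ofReal ((w⁻¹ * ∫ s in (0 : ℝ)..w, F (Φ.flow s z)) ^ 2) ∂μ ≤
      ∫⁻ z, ENNReal.ofReal (F z ^ 2) ∂μ := by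
  have hae : ∀ᵐ z ∂μ, z ∈ Φ.good := mem_ae_iff.2 hgood
  have hF2 : Continuous fun x => F x ^ 2 := hF.pow 2
  have hwi : w⁻¹ * w = 1 := inv_mul_cancel₀ hw.ne'
  have hpt : ∀ᵐ z ∂μ, ENNReal.ofReal ((w⁻¹ * ∫ s in (0 : ℝ)..w, F (Φ.flow s z)) ^ 2) ≤
      ENNReal.ofReal w⁻¹ * ENNReal.ofReal (∫ s in (0 : ℝ)..w, F (Φ.flow s z) ^ 2) := by
    filter_upwards [hae] with z hz
    have hcs := sq_integral_le_mul_integral_sq hw.le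
      (Φ.intervalIntegrable_comp_flow_of_continuous hz hF 0 w)
      (Φ.intervalIntegrable_comp_flow_of_continuous hz hF2 0 w)
    rw [sub_zero] at hcs
    rw [← ENNReal.ofReal_mul (inv_nonneg.2 hw.le)]
    refine ENNReal.ofReal_le_ofReal ?_
    calc (w⁻¹ * ∫ s in (0 : ℝ)..w, F (Φ.flow s z)) ^ 2
        = w⁻¹ ^ 2 * (∫ s in (0 : ℝ)..w, F (Φ.flow s z)) ^ 2 := by rw [mul_pow]
      _ ≤ w⁻¹ ^ 2 * (w * ∫ s in (0 : ℝ)..w, F (Φ.flow s z) ^ 2) :=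
          mul_le_mul_of_nonneg_left hcs (sq_nonneg _)
      _ = w⁻¹ * ∫ s in (0 : ℝ)..w, F (Φ.flow s z) ^ 2 := by
          rw [sq w⁻¹, mul_assoc, ← mul_assoc w⁻¹ w, hwi, one_mul]
  calc ∫⁻ z, ENNReal.ofReal ((w⁻¹ * ∫ s in (0 : ℝ)..w, F (Φ.flow s z)) ^ 2) ∂μ
      ≤ ∫⁻ z, ENNReal.ofReal w⁻¹ * ENNReal.ofReal (∫ s in (0 : ℝ)..w, F (Φ.flow s z) ^ 2) ∂μ :=
        lintegral_mono_ae hpt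
    _ = ENNReal.ofReal w⁻¹ * (ENNReal.ofReal (w - 0) * ∫⁻ z, ENNReal.ofReal (F z ^ 2) ∂μ) := by
        rw [lintegral_const_mul' _ _ ENNReal.ofReal_ne_top,
          lintegral_ofReal_window_of_continuous Φ μ hinv hgood hF2 (fun _ => sq_nonneg _) hw.le]
    _ = ∫⁻ z, ENNReal.ofReal (F z ^ 2) ∂μ := by
        rw [sub_zero, ← mul_assoc, ← ENNReal.ofReal_mul (inv_nonneg.2 hw.le), hwi,
          ENNReal.ofReal_one, one_mul]

/-- Time rescaling of a window along the flow: `T⁻¹ ∫₀ᵀ A(Φ_{sc} z) ds = (Tc)⁻¹ ∫₀^{Tc} A(Φ_u z) du`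
(`c ≠ 0`; change of variables `u = sc`). [folklore] -/
theorem window_rescale_flow (Φ : HardSphereFlow (Torus.geometry (Fin 3)) ε N)
    (A : Config N (Fin 3) T3 → ℝ) (z : Config N (Fin 3) T3) (T : ℝ) {c : ℝ} (hc : c ≠ 0) :
    T⁻¹ * ∫ s in (0 : ℝ)..T, A (Φ.flow (s * c) z) =
      (T * c)⁻¹ * ∫ u in (0 : ℝ)..T * c, A (Φ.flow u z) := by
  rw [intervalIntegral.integral_comp_mul_right (fun u => A (Φ.flow u z)) hc, zero_mul, smul_eq_mul,
    mul_inv, mul_assoc]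

/-- A continuous observable along a linearly reparametrised good orbit `s ↦ Φ_{sc} z` (`c ≠ 0`) is
interval integrable. [folklore] -/
theorem intervalIntegrable_comp_flow_mul (Φ : HardSphereFlow (Torus.geometry (Fin 3)) ε N)
    {z : Config N (Fin 3) T3} (hz : z ∈ Φ.good) {F : Config N (Fin 3) T3 → ℝ} (hF : Continuous F)
    {c : ℝ} (hc : c ≠ 0) (a b : ℝ) :
    IntervalIntegrable (fun s => F (Φ.flow (s * c) z)) volume a b := by
  have h := (Φ.intervalIntegrable_comp_flow_of_continuous hz hF (a * c) (b * c)).comp_mul_right (c := c)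
  rwa [mul_div_cancel_right₀ a hc, mul_div_cancel_right₀ b hc] at h

/-- Rescaled window integrals of a measurable observable are a.e.-measurable for every law carried by
the good set (`HardSphereFlow.aemeasurable_intervalIntegral_comp_flow_torus` after `u = sc`).
[folklore] -/
theorem aemeasurable_window_mul (Φ : HardSphereFlow (Torus.geometry (Fin 3)) ε N)
    {μ : Measure (Config N (Fin 3) T3)} (hgood : μ Φ.goodᶜ = 0)
    {F : Config N (Fin 3) T3 → ℝ} (hF : Measurable F) (T : ℝ) {c : ℝ} (hc : c ≠ 0) :
    AEMeasurable (fun z => ∫ s in (0 : ℝ)..T, F (Φ.flow (s * c) z)) μ := by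
  have e : (fun z => ∫ s in (0 : ℝ)..T, F (Φ.flow (s * c) z)) =
      fun z => c⁻¹ * ∫ u in (0 : ℝ) * c..T * c, F (Φ.flow u z) := by
    funext z
    rw [intervalIntegral.integral_comp_mul_right (fun u => F (Φ.flow u z)) hc, smul_eq_mul]
  rw [e]
  exact (Φ.aemeasurable_intervalIntegral_comp_flow_torus hF _ _ hgood).const_mul _

end Flow

/-! ### The one-body field of a continuous profile -/

/-- The one-body empirical field of continuous `χ, h` is a continuous function of the configuration
(a finite sum of continuous functions of the coordinates). [folklore] -/
theorem continuous_oneBodyField {n : ℕ} {χ : T3 → ℝ} (hχ : Continuous χ) {h : V3 → ℝ}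
    (hh : Continuous h) :
    Continuous fun z : Config n (Fin 3) T3 => ∫ y, χ y.1 * h y.2 ∂(empiricalMeasure z) := by
  have e : (fun z : Config n (Fin 3) T3 => ∫ y, χ y.1 * h y.2 ∂(empiricalMeasure z)) =
      fun z => (n : ℝ)⁻¹ * ∑ i, χ (z i).1 * h (z i).2 :=
    funext fun z => oneBodyField_eq_sum χ h z
  rw [e]
  exact continuous_const.mul (continuous_finsetSum _ fun i _ =>
    (hχ.comp (continuous_apply i).fst).mul (hh.comp (continuous_apply i).snd))

/-- The one-body field is additive in the profile: `A_h = A_g + A_f` when `h = g + f`. [folklore] -/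
theorem oneBodyField_split {n : ℕ} (χ : T3 → ℝ) {h g f : V3 → ℝ} (hsum : ∀ v, h v = g v + f v)
    (z : Config n (Fin 3) T3) :
    ∫ y, χ y.1 * h y.2 ∂(empiricalMeasure z) =
      (∫ y, χ y.1 * g y.2 ∂(empiricalMeasure z)) + ∫ y, χ y.1 * f y.2 ∂(empiricalMeasure z) := by
  rw [oneBodyField_eq_sum χ h z, oneBodyField_eq_sum χ g z, oneBodyField_eq_sum χ f z, ← mul_add,
    ← Finset.sum_add_distrib]
  congr 1
  exact Finset.sum_congr rfl fun i _ => by rw [hsum, mul_add]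

/-! ### The uniform seminorm bound -/

/-- **Seminorm bound.** For a mean-zero continuous polynomially bounded profile `f`, a continuous `χ`,
every window `T > 0` and every `N`:
`F_N^f(T) = ∫ (T⁻¹ ∫₀ᵀ A_f((Φ)_{s(N+1)^{-1/3}} z) ds)² dG ≤ ((∫ χ²) ∫ f² M_θ)/(N+1)`
(time rescaling, Cauchy–Schwarz in time, Tonelli + invariance, `torusStaticVariance`). [folklore] -/
theorem fejer_le_static {σ : ℝ} (hσ : 0 < σ) (hσ2 : σ < 1 / 2) {θ : ℝ} (hθ : 0 < θ)
    {f : V3 → ℝ} (hf : Continuous f) (hpoly : ∃ (C : ℝ) (k : ℕ), ∀ v, |f v| ≤ C * (1 + ‖v‖) ^ k)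
    (f1 : ∫ v, f v * localMaxwellian 1 θ (0 : V3) v = 0) (N : ℕ)
    (Φ : HardSphereFlow (Torus.geometry (Fin 3)) (hsDiameter σ N) (N + 1)) {χ : T3 → ℝ}
    (hχ : Continuous χ) {T : ℝ} (hT : 0 < T) :
    ∫⁻ z, ENNReal.ofReal ((T⁻¹ * ∫ s in (0 : ℝ)..T,
        ∫ y, χ y.1 * f y.2
          ∂(empiricalMeasure (Φ.flow (s * ((N : ℝ) + 1) ^ (-(1 / 3 : ℝ))) z))) ^ 2)
      ∂(localGibbsLaw σ (fun _ => 1) (fun _ => 0) (fun _ => θ) N Φ) ≤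
      ENNReal.ofReal ((∫ x, χ x * χ x) * (∫ v, f v ^ 2 * localMaxwellian 1 θ (0 : V3) v) /
        ((N : ℝ) + 1)) := by
  obtain ⟨C, k, hCk⟩ := hpoly
  haveI := isProbabilityMeasure_localGibbsLaw_const (σ := σ) hθ hσ2.le (0 : V3) N Φ
  have hgood : (localGibbsLaw σ (fun _ => 1) (fun _ => 0) (fun _ => θ) N Φ) Φ.goodᶜ = 0 :=
    mem_ae_iff.1 (ae_mem_good_localGibbsLaw σ (fun _ => 1) (fun _ => 0) (fun _ => θ) N Φ)
  have hinv := measurePreserving_flow_localGibbsLaw_const σ 1 θ 0 N Φ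
  have hc0 : 0 < ((N : ℝ) + 1) ^ (-(1 / 3 : ℝ)) := Real.rpow_pos_of_pos (by positivity) _
  have hA : Continuous fun z : Config (N + 1) (Fin 3) T3 =>
      ∫ y, χ y.1 * f y.2 ∂(empiricalMeasure z) := continuous_oneBodyField hχ hf
  have hstat := torusStaticVariance σ hσ hσ2 θ hθ f hf ⟨C, k, hCk⟩ f1 N Φ χ hχ
  have h0 : ∫ z, (∫ y, χ y.1 * f y.2 ∂(empiricalMeasure (Φ.flow 0 z))) *
        (∫ y, χ y.1 * f y.2 ∂(empiricalMeasure z))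
        ∂(localGibbsLaw σ (fun _ => 1) (fun _ => 0) (fun _ => θ) N Φ) =
      ∫ z, (∫ y, χ y.1 * f y.2 ∂(empiricalMeasure z)) ^ 2
        ∂(localGibbsLaw σ (fun _ => 1) (fun _ => 0) (fun _ => θ) N Φ) := by
    refine integral_congr_ae ?_
    filter_upwards [ae_mem_good_localGibbsLaw σ (fun _ => 1) (fun _ => 0) (fun _ => θ) N Φ] with z hz
    rw [Φ.flow_zero z hz, sq]
  rw [h0] at hstat
  have hsq : ∫ z, (∫ y, χ y.1 * f y.2 ∂(empiricalMeasure z)) ^ 2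
        ∂(localGibbsLaw σ (fun _ => 1) (fun _ => 0) (fun _ => θ) N Φ) =
      (∫ x, χ x * χ x) * (∫ v, f v ^ 2 * localMaxwellian 1 θ (0 : V3) v) / ((N : ℝ) + 1) := by
    rw [eq_div_iff (by positivity : ((N : ℝ) + 1) ≠ 0), mul_comm]
    exact hstat
  calc ∫⁻ z, ENNReal.ofReal ((T⁻¹ * ∫ s in (0 : ℝ)..T,
          ∫ y, χ y.1 * f y.2
            ∂(empiricalMeasure (Φ.flow (s * ((N : ℝ) + 1) ^ (-(1 / 3 : ℝ))) z))) ^ 2)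
        ∂(localGibbsLaw σ (fun _ => 1) (fun _ => 0) (fun _ => θ) N Φ)
      = ∫⁻ z, ENNReal.ofReal (((T * ((N : ℝ) + 1) ^ (-(1 / 3 : ℝ)))⁻¹ *
          ∫ u in (0 : ℝ)..T * ((N : ℝ) + 1) ^ (-(1 / 3 : ℝ)),
            ∫ y, χ y.1 * f y.2 ∂(empiricalMeasure (Φ.flow u z))) ^ 2)
          ∂(localGibbsLaw σ (fun _ => 1) (fun _ => 0) (fun _ => θ) N Φ) :=
        lintegral_congr fun z => by
          rw [window_rescale_flow Φ (fun w => ∫ y, χ y.1 * f y.2 ∂(empiricalMeasure w)) z T hc0.ne']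
    _ ≤ ∫⁻ z, ENNReal.ofReal ((∫ y, χ y.1 * f y.2 ∂(empiricalMeasure z)) ^ 2)
          ∂(localGibbsLaw σ (fun _ => 1) (fun _ => 0) (fun _ => θ) N Φ) :=
        lintegral_sq_window_le Φ _ hinv hgood hA (mul_pos hT hc0)
    _ = ENNReal.ofReal (∫ z, (∫ y, χ y.1 * f y.2 ∂(empiricalMeasure z)) ^ 2
          ∂(localGibbsLaw σ (fun _ => 1) (fun _ => 0) (fun _ => θ) N Φ)) :=
        (ofReal_integral_eq_lintegral_ofReal
          (memLp_two_oneBodyField_localGibbsLaw_one hθ hσ2.le N Φ hχ hf hCk).integrable_sq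
          (Eventually.of_forall fun z => sq_nonneg _)).symm
    _ = _ := by rw [hsq]

/-- A continuous polynomially bounded profile minus a bounded one is polynomially bounded. [folklore] -/
theorem poly_bound_sub {h g : V3 → ℝ} {C K : ℝ} {k : ℕ} (hCk : ∀ v, |h v| ≤ C * (1 + ‖v‖) ^ k)
    (hK : ∀ v, |g v| ≤ K) (v : V3) : |h v - g v| ≤ (C + |K|) * (1 + ‖v‖) ^ k := by
  have h1 : (1 : ℝ) ≤ (1 + ‖v‖) ^ k := one_le_pow₀ (by linarith [norm_nonneg v])
  calc |h v - g v| ≤ |h v| + |g v| := abs_sub _ _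
    _ ≤ C * (1 + ‖v‖) ^ k + |K| * (1 + ‖v‖) ^ k :=
        add_le_add (hCk v) ((hK v).trans ((le_abs_self K).trans
          (le_mul_of_one_le_right (abs_nonneg K) h1)))
    _ = (C + |K|) * (1 + ‖v‖) ^ k := by ring

end stub_profileDensityAllAux

open stub_profileDensityAllAux in
/-- **STUB S3 `stub_profileDensityAll`** of the line `torus_fejer` (v2) of crux
stmt-AtomisticToContinuum-9583 (`OneBodyCompleteness`): fix `0 < σ < 1/2`, `θ > 0`, a flow family `Φ`
and a continuous `χ`.  If the window variance of the one-body field decays at all large windows for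
EVERY bounded continuous `g ⊥ {1, v, |v|²}` (in `L²(M_θ)`), then it does so for every continuous
polynomially bounded `h ⊥ {1, v, |v|²}`: (i) bounded continuous profiles `⊥ {1, v, |v|²}` are
`L²(M_θ)`-dense among such profiles (`exists_bdd_cont_orth_five`); (ii) the uniform seminorm bound
`(N+1) F_N^f(T) ≤ (∫χ²)(∫f²M_θ)` for mean-zero `f` (`fejer_le_static`); (iii) `A_h = A_g + A_{h-g}`,
`(x+y)² ≤ 2x² + 2y²`. [folklore; Spohn 1991 §II.7.1] -/
theorem stub_profileDensityAll :
    ∀ σ : ℝ, 0 < σ → σ < 1 / 2 → ∀ θ : ℝ, 0 < θ →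
      ∀ (Φ : (N : ℕ) → HardSphereFlow (Torus.geometry (Fin 3)) (hsDiameter σ N) (N + 1))
        (χ : T3 → ℝ), Continuous χ →
        (∀ g : V3 → ℝ, Continuous g → (∃ K : ℝ, ∀ v, |g v| ≤ K) →
          (∫ v, g v * localMaxwellian 1 θ (0 : V3) v = 0) →
          (∀ i : Fin 3, ∫ v, g v * v i * localMaxwellian 1 θ (0 : V3) v = 0) →
          (∫ v, g v * ‖v‖ ^ 2 * localMaxwellian 1 θ (0 : V3) v = 0) →
          ∀ δ : ℝ, 0 < δ → ∃ T₀ : ℝ, 0 < T₀ ∧ ∀ T : ℝ, T₀ ≤ T → ∃ N₀ : ℕ, ∀ N : ℕ, N₀ ≤ N →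
            ∫⁻ z, ENNReal.ofReal ((T⁻¹ * ∫ s in (0 : ℝ)..T,
                ∫ y, χ y.1 * g y.2
                  ∂(empiricalMeasure ((Φ N).flow (s * ((N : ℝ) + 1) ^ (-(1 / 3 : ℝ))) z))) ^ 2)
              ∂(localGibbsLaw σ (fun _ => 1) (fun _ => 0) (fun _ => θ) N (Φ N))
              ≤ ENNReal.ofReal (δ / ((N : ℝ) + 1))) →
        ∀ h : V3 → ℝ, Continuous h → (∃ (C : ℝ) (k : ℕ), ∀ v, |h v| ≤ C * (1 + ‖v‖) ^ k) →
          (∫ v, h v * localMaxwellian 1 θ (0 : V3) v = 0) →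
          (∀ i : Fin 3, ∫ v, h v * v i * localMaxwellian 1 θ (0 : V3) v = 0) →
          (∫ v, h v * ‖v‖ ^ 2 * localMaxwellian 1 θ (0 : V3) v = 0) →
          ∀ δ : ℝ, 0 < δ → ∃ T₀ : ℝ, 0 < T₀ ∧ ∀ T : ℝ, T₀ ≤ T → ∃ N₀ : ℕ, ∀ N : ℕ, N₀ ≤ N →
            ∫⁻ z, ENNReal.ofReal ((T⁻¹ * ∫ s in (0 : ℝ)..T,
                ∫ y, χ y.1 * h y.2
                  ∂(empiricalMeasure ((Φ N).flow (s * ((N : ℝ) + 1) ^ (-(1 / 3 : ℝ))) z))) ^ 2)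
              ∂(localGibbsLaw σ (fun _ => 1) (fun _ => 0) (fun _ => θ) N (Φ N))
              ≤ ENNReal.ofReal (δ / ((N : ℝ) + 1)) := by
  intro σ hσ hσ2 θ hθ Φ χ hχ H h hh hpoly h1 hv hE δ hδ
  obtain ⟨C, k, hCk⟩ := hpoly
  have hIχ : 0 ≤ ∫ x, χ x * χ x := integral_nonneg fun x => mul_self_nonneg _
  -- (i) density: a bounded continuous `g ⊥ {1, v, |v|²}` with `(∫χ²) ∫ (h - g)² M_θ ≤ δ/4`
  have hε : 0 < δ / (4 * ((∫ x, χ x * χ x) + 1)) := by positivity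
  obtain ⟨g, hg, ⟨K, hK⟩, g1, gv, gE, hle⟩ := exists_bdd_cont_orth_five hθ hh hCk h1 hv hE hε
  set f : V3 → ℝ := fun v => h v - g v with hf
  have hfc : Continuous f := hh.sub hg
  have hfpoly : ∃ (C' : ℝ) (k' : ℕ), ∀ v, |f v| ≤ C' * (1 + ‖v‖) ^ k' :=
    ⟨C + |K|, k, fun v => poly_bound_sub hCk hK v⟩
  have hf1 : ∫ v, f v * localMaxwellian 1 θ (0 : V3) v = 0 := by
    have hhi : Integrable h (gaussMeasure (0 : V3) θ) :=
      integrable_of_poly_growth _ hh.aestronglyMeasurable hCk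
    have hgi : Integrable g (gaussMeasure (0 : V3) θ) :=
      integrable_of_poly_growth _ hg.aestronglyMeasurable (C := K) (k := 0) fun v => by
        rw [pow_zero, mul_one]; exact hK v
    rw [← integral_gaussMeasure_eq_integral_mul hθ f]
    show ∫ v, (h v - g v) ∂(gaussMeasure (0 : V3) θ) = 0
    rw [integral_sub hhi hgi, integral_gaussMeasure_eq_integral_mul hθ h,
      integral_gaussMeasure_eq_integral_mul hθ g, h1, g1, sub_self]
  have hf2 : (∫ x, χ x * χ x) * ∫ v, f v ^ 2 * localMaxwellian 1 θ (0 : V3) v ≤ δ / 4 := by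
    have hle' : ∫ v, f v ^ 2 * localMaxwellian 1 θ (0 : V3) v ≤ δ / (4 * ((∫ x, χ x * χ x) + 1)) :=
      hle
    have key : (∫ x, χ x * χ x) * (δ / (4 * ((∫ x, χ x * χ x) + 1))) ≤ δ / 4 := by
      rw [← mul_div_assoc, div_le_div_iff₀ (by positivity) (by positivity)]
      nlinarith [hIχ, hδ.le]
    exact (mul_le_mul_of_nonneg_left hle' hIχ).trans key
  -- (ii) the hypothesis for `g` at `δ/4`
  obtain ⟨T₀, hT₀, hT⟩ := H g hg ⟨K, hK⟩ g1 gv gE (δ / 4) (by positivity)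
  refine ⟨T₀, hT₀, fun T hTT => ?_⟩
  obtain ⟨N₀, hN⟩ := hT T hTT
  refine ⟨N₀, fun N hNN => ?_⟩
  have hTpos : 0 < T := hT₀.trans_le hTT
  have hgN := hN N hNN
  have hfN := fejer_le_static hσ hσ2 hθ hfc hfpoly hf1 N (Φ N) hχ hTpos
  haveI := isProbabilityMeasure_localGibbsLaw_const (σ := σ) hθ hσ2.le (0 : V3) N (Φ N)
  have hgood : (localGibbsLaw σ (fun _ => 1) (fun _ => 0) (fun _ => θ) N (Φ N)) (Φ N).goodᶜ = 0 :=
    mem_ae_iff.1 (ae_mem_good_localGibbsLaw σ (fun _ => 1) (fun _ => 0) (fun _ => θ) N (Φ N))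
  set c : ℝ := ((N : ℝ) + 1) ^ (-(1 / 3 : ℝ)) with hc
  have hc0 : 0 < c := Real.rpow_pos_of_pos (by positivity) _
  have hsum : ∀ v, h v = g v + f v := fun v => by
    show h v = g v + (h v - g v)
    ring
  -- (iii) pointwise on good orbits: `A_h = A_g + A_f`, `(x + y)² ≤ 2x² + 2y²`
  have hpt : ∀ᵐ z ∂(localGibbsLaw σ (fun _ => 1) (fun _ => 0) (fun _ => θ) N (Φ N)),
      ENNReal.ofReal ((T⁻¹ * ∫ s in (0 : ℝ)..T,
          ∫ y, χ y.1 * h y.2 ∂(empiricalMeasure ((Φ N).flow (s * c) z))) ^ 2) ≤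
        2 * ENNReal.ofReal ((T⁻¹ * ∫ s in (0 : ℝ)..T,
          ∫ y, χ y.1 * g y.2 ∂(empiricalMeasure ((Φ N).flow (s * c) z))) ^ 2) +
        2 * ENNReal.ofReal ((T⁻¹ * ∫ s in (0 : ℝ)..T,
          ∫ y, χ y.1 * f y.2 ∂(empiricalMeasure ((Φ N).flow (s * c) z))) ^ 2) := by
    filter_upwards [ae_mem_good_localGibbsLaw σ (fun _ => 1) (fun _ => 0) (fun _ => θ) N (Φ N)] with z hz
    have hig : IntervalIntegrable
        (fun s => ∫ y, χ y.1 * g y.2 ∂(empiricalMeasure ((Φ N).flow (s * c) z))) volume 0 T :=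
      intervalIntegrable_comp_flow_mul (Φ N) hz (continuous_oneBodyField hχ hg) hc0.ne' 0 T
    have hif : IntervalIntegrable
        (fun s => ∫ y, χ y.1 * f y.2 ∂(empiricalMeasure ((Φ N).flow (s * c) z))) volume 0 T :=
      intervalIntegrable_comp_flow_mul (Φ N) hz (continuous_oneBodyField hχ hfc) hc0.ne' 0 T
    have hsplit : (∫ s in (0 : ℝ)..T, ∫ y, χ y.1 * h y.2 ∂(empiricalMeasure ((Φ N).flow (s * c) z))) =
        ∫ s in (0 : ℝ)..T, ((∫ y, χ y.1 * g y.2 ∂(empiricalMeasure ((Φ N).flow (s * c) z))) +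
          ∫ y, χ y.1 * f y.2 ∂(empiricalMeasure ((Φ N).flow (s * c) z))) :=
      intervalIntegral.integral_congr fun s _ => oneBodyField_split χ hsum _
    rw [hsplit, intervalIntegral.integral_add hig hif, mul_add]
    have h2 : ∀ X Y : ℝ, ENNReal.ofReal ((X + Y) ^ 2) ≤
        2 * ENNReal.ofReal (X ^ 2) + 2 * ENNReal.ofReal (Y ^ 2) := by
      intro X Y
      have hXY : (X + Y) ^ 2 ≤ 2 * X ^ 2 + 2 * Y ^ 2 := by nlinarith [sq_nonneg (X - Y)]
      have hX : (0 : ℝ) ≤ 2 * X ^ 2 := by positivity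
      have hY : (0 : ℝ) ≤ 2 * Y ^ 2 := by positivity
      calc ENNReal.ofReal ((X + Y) ^ 2) ≤ ENNReal.ofReal (2 * X ^ 2 + 2 * Y ^ 2) :=
            ENNReal.ofReal_le_ofReal hXY
        _ = 2 * ENNReal.ofReal (X ^ 2) + 2 * ENNReal.ofReal (Y ^ 2) := by
            rw [ENNReal.ofReal_add hX hY, ENNReal.ofReal_mul zero_le_two,
              ENNReal.ofReal_mul zero_le_two, ENNReal.ofReal_ofNat]
    exact h2 _ _
  -- a.e.-measurability of the `g`-window term
  have hmg : AEMeasurable (fun z => 2 * ENNReal.ofReal ((T⁻¹ * ∫ s in (0 : ℝ)..T,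
      ∫ y, χ y.1 * g y.2 ∂(empiricalMeasure ((Φ N).flow (s * c) z))) ^ 2))
      (localGibbsLaw σ (fun _ => 1) (fun _ => 0) (fun _ => θ) N (Φ N)) :=
    ((((aemeasurable_window_mul (Φ N) hgood (measurable_oneBodyField hχ hg) T hc0.ne').const_mul
      T⁻¹).pow_const 2).ennreal_ofReal).const_mul _
  have hfN' : ∫⁻ z, ENNReal.ofReal ((T⁻¹ * ∫ s in (0 : ℝ)..T,
        ∫ y, χ y.1 * f y.2 ∂(empiricalMeasure ((Φ N).flow (s * c) z))) ^ 2)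
        ∂(localGibbsLaw σ (fun _ => 1) (fun _ => 0) (fun _ => θ) N (Φ N)) ≤
      ENNReal.ofReal (δ / 4 / ((N : ℝ) + 1)) :=
    hfN.trans (ENNReal.ofReal_le_ofReal (div_le_div_of_nonneg_right hf2 (by positivity)))
  have hx2 : 0 ≤ 2 * (δ / 4 / ((N : ℝ) + 1)) := by positivity
  calc ∫⁻ z, ENNReal.ofReal ((T⁻¹ * ∫ s in (0 : ℝ)..T,
          ∫ y, χ y.1 * h y.2 ∂(empiricalMeasure ((Φ N).flow (s * c) z))) ^ 2)
        ∂(localGibbsLaw σ (fun _ => 1) (fun _ => 0) (fun _ => θ) N (Φ N))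
      ≤ ∫⁻ z, (2 * ENNReal.ofReal ((T⁻¹ * ∫ s in (0 : ℝ)..T,
            ∫ y, χ y.1 * g y.2 ∂(empiricalMeasure ((Φ N).flow (s * c) z))) ^ 2) +
          2 * ENNReal.ofReal ((T⁻¹ * ∫ s in (0 : ℝ)..T,
            ∫ y, χ y.1 * f y.2 ∂(empiricalMeasure ((Φ N).flow (s * c) z))) ^ 2))
          ∂(localGibbsLaw σ (fun _ => 1) (fun _ => 0) (fun _ => θ) N (Φ N)) :=
        lintegral_mono_ae hpt
    _ = 2 * ∫⁻ z, ENNReal.ofReal ((T⁻¹ * ∫ s in (0 : ℝ)..T,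
            ∫ y, χ y.1 * g y.2 ∂(empiricalMeasure ((Φ N).flow (s * c) z))) ^ 2)
            ∂(localGibbsLaw σ (fun _ => 1) (fun _ => 0) (fun _ => θ) N (Φ N)) +
          2 * ∫⁻ z, ENNReal.ofReal ((T⁻¹ * ∫ s in (0 : ℝ)..T,
            ∫ y, χ y.1 * f y.2 ∂(empiricalMeasure ((Φ N).flow (s * c) z))) ^ 2)
            ∂(localGibbsLaw σ (fun _ => 1) (fun _ => 0) (fun _ => θ) N (Φ N)) := by
        rw [lintegral_add_left' hmg, lintegral_const_mul' _ _ ENNReal.ofNat_ne_top,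
          lintegral_const_mul' _ _ ENNReal.ofNat_ne_top]
    _ ≤ 2 * ENNReal.ofReal (δ / 4 / ((N : ℝ) + 1)) + 2 * ENNReal.ofReal (δ / 4 / ((N : ℝ) + 1)) := by
        gcongr
    _ = ENNReal.ofReal (δ / ((N : ℝ) + 1)) := by
        rw [← ENNReal.ofReal_ofNat 2, ← ENNReal.ofReal_mul zero_le_two, ← ENNReal.ofReal_add hx2 hx2]
        congr 1
        ring

end Summit.AtomisticToContinuum.HydrodynamicLimit.Theorems.MourreKoopmanChargesOneBodyCompleteness

end
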